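import Summits.BirchSwinnertonDyer.BirchSwinnertonDyer.Theorems.AlignedTransportAtTwoBSDOfMainConjectureRankOneAtTwoSigmaSqTwoFrobeniusModel
import Literature.NumberTheory.EllipticCurves.FormalGroupDictionaryProofs
import HarnessLib

/-!
# Glue lemmas for the Dwork step of the `σ²`-at-`2` discharge: base change of the closed-form series, of the Frobenius model, and the
# coefficient bookkeeping `T ≡ z²`, `V ≡ 1 (mod 2)` read through a ring map (step S6 of the plan for the PRINT stub `stub_sigmaSqTwo`)

Cell `bsd-f1-sign2`, WIDTH-5 attach seat `bsd-line-att-p3` g9 (`--supports stmt-BirchSwinnertonDyer-23008`; plan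
`Cruxes/BSDOfMainConjectureRankOneAtTwo/SIGMASQ-AT-TWO-att-p3.md` §8). THEOREMS ONLY, over ABSTRACT commutative rings and a ring map `φ : A → B`
(instantiated with `R̂₂ → K₂ = R̂₂[1/2]` in `…SigmaSqTwoExistence.lean`; keeping these manipulations abstract keeps the elaboration of the concrete
`2`-adic completion cheap). BSD is not proved by any of this.

* `frob_map_series` — `𝒜, 𝒰, 𝒬, 𝒢, 𝔇, N₂` commute with `φ`;  `frobModel_curve_map` — the Frobenius model is `⟨1, b₂′, 0, 0, b₆′⟩^φ`;
* `frob_T_eq_map`, `frob_V_eq_map` — `T = φ_*(N₂·𝔇⁻¹)`, `V = φ_*(𝔇²·(𝒬𝒰²)⁻¹)`;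
* `frob_dwork_hφ`, `frob_dwork_hu`, `frob_dwork_hu0` — the hypotheses `hφ`, `hu`, `hu0` of the tree's Dwork lemma
  `Literature.RingTheory.FormalGroups.coeff_mem_of_map_subst_eq_pow_mul` from `frob_coeff_N2_sub_mem` / `frob_coeff_calD_sq_sub_mem`;
* small normal-form lemmas (`frob_sigmaShift_two`, `frob_map_sigmaShift_sq`, `frob_coeff_sq_mem`, `frob_coeff_one_sigmaShift_sq_eq_one`, …).

## Sources
C. Blakestad, D. Grant, J. Number Theory 249 (2023), Lemma 5, Cor. 6, Prop. 13 [cite: BlakestadGrant2023, Prop. 13]; N. Koblitz, GTM 58, Ch. IV §2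
Lemma 3 [cite: Koblitz1984, Ch. IV §2 Lemma 3].
-/

noncomputable section

set_option linter.dupNamespace false
set_option autoImplicit false

open scoped Classical
open PowerSeries WeierstrassCurve Literature.NumberTheory.EllipticCurves

namespace Summit.BirchSwinnertonDyer.BirchSwinnertonDyer.Theorems.AlignedTransportAtTwoSigmaSqTwo

/-- Coefficients of `f·g` lie in an ideal containing all coefficients of `f`. [folklore] -/
theorem coeff_mul_mem_of_coeff_mem {A : Type*} [CommRing A] (I : Ideal A) {f : A⟦X⟧} (hf : ∀ n, coeff n f ∈ I) (g : A⟦X⟧) (n : ℕ) :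
    coeff n (f * g) ∈ I := by
  refine coeff_mem_of_map_mk_eq_zero I ?_ n
  have h0 : PowerSeries.map (Ideal.Quotient.mk I) f = 0 := by
    ext k; rw [coeff_map, map_zero, Ideal.Quotient.eq_zero_iff_mem]; exact hf k
  rw [map_mul, h0, zero_mul]

/-- In a commutative ring two right inverses of the same element agree. [folklore] -/
theorem inv_unique_aux {A : Type*} [CommRing A] {u a b : A} (ha : u * a = 1) (hb : u * b = 1) : a = b := by
  calc a = a * (u * b) := by rw [hb, mul_one]
    _ = (u * a) * b := by ring
    _ = b := by rw [ha, one_mul]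

/-- The closed-form series `𝒜, 𝒰, 𝒬, 𝒢, 𝔇, N₂` commute with base change along a ring map `φ`. [folklore] -/
theorem frob_map_series {A B : Type*} [CommRing A] [CommRing B] (φ : A →+* B) (V : WeierstrassCurve A) (W : WeierstrassCurve B)
    (hW : W = V.map φ) {X0 B2 g2 d : A} {cA cU cQ cG cD : A⟦X⟧} {cA' cU' cQ' cG' cD' : B⟦X⟧}
    (hA : cA = 4 * V.formalXMulSq - C X0 * X ^ 2)
    (hU : cU = V.formalXMulSq ^ 2 - 8 * C d * V.formalXMulSq * X ^ 2 + 2 * (C d * C X0 - 4 * C g2 * C X0) * X ^ 4)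
    (hQ : cQ = V.formalXMulSq ^ 2 - 16 * C g2 * V.formalXMulSq * X ^ 2 - 4 * C g2 * C X0 * X ^ 4)
    (hG : cG = (-C B2 - 32 * C g2) * V.formalXMulSq ^ 2 - 4 * (1 + 2 * C B2) * C d * V.formalXMulSq * X ^ 2 +
        (1 + 2 * C B2) * (C d * C X0 - 4 * C g2 * C X0) * X ^ 4 - 8 * C g2 * C X0 * V.formalXMulSq * X ^ 2 -
        2 * C g2 * C X0 ^ 2 * X ^ 4)
    (hD : cD = (1 + 2 * C B2) * X * V.formalXMulSq * cU + V.formalXMulSq ^ 2 * cQ + 8 * C g2 * C X0 * X ^ 4 * cQ -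
        X ^ 2 * V.formalXMulSq * cG)
    (hA' : cA' = 4 * W.formalXMulSq - C (φ X0) * X ^ 2)
    (hU' : cU' = W.formalXMulSq ^ 2 - 8 * C (φ d) * W.formalXMulSq * X ^ 2 + 2 * (C (φ d) * C (φ X0) - 4 * C (φ g2) * C (φ X0)) * X ^ 4)
    (hQ' : cQ' = W.formalXMulSq ^ 2 - 16 * C (φ g2) * W.formalXMulSq * X ^ 2 - 4 * C (φ g2) * C (φ X0) * X ^ 4)
    (hG' : cG' = (-C (φ B2) - 32 * C (φ g2)) * W.formalXMulSq ^ 2 - 4 * (1 + 2 * C (φ B2)) * C (φ d) * W.formalXMulSq * X ^ 2 +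
        (1 + 2 * C (φ B2)) * (C (φ d) * C (φ X0) - 4 * C (φ g2) * C (φ X0)) * X ^ 4 - 8 * C (φ g2) * C (φ X0) * W.formalXMulSq * X ^ 2 -
        2 * C (φ g2) * C (φ X0) ^ 2 * X ^ 4)
    (hD' : cD' = (1 + 2 * C (φ B2)) * X * W.formalXMulSq * cU' + W.formalXMulSq ^ 2 * cQ' + 8 * C (φ g2) * C (φ X0) * X ^ 4 * cQ' -
        X ^ 2 * W.formalXMulSq * cG') :
    PowerSeries.map φ cA = cA' ∧ PowerSeries.map φ cU = cU' ∧ PowerSeries.map φ cQ = cQ' ∧ PowerSeries.map φ cG = cG' ∧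
      PowerSeries.map φ cD = cD' ∧
      PowerSeries.map φ ((1 + 2 * C B2) * X * (2 - X) * V.formalXMulSq * cU) = (1 + 2 * C (φ B2)) * X * (2 - X) * W.formalXMulSq * cU' := by
  subst hW hA hU hQ hG hD hA' hU' hQ' hG' hD'
  simp only [map_sub, map_add, map_neg, map_mul, map_pow, map_C, map_X, map_ofNat, map_one, map_formalXMulSq, and_self]

/-- **The Frobenius model is the base change of the chart curve `⟨1, b₂′, 0, 0, b₆′⟩` over the coefficient ring** (`frobModel_curve` read
through a ring map `φ : A → K`, with `b₂′, b₆′ ∈ A` in the normal form of `frobParam_beta2/6_sub_mem`). [cite: BlakestadGrant2023, Prop. 7] -/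
theorem frobModel_curve_map {A K : Type*} [CommRing A] [CommRing K] [Algebra ℚ K] (φ : A →+* K) (V V' : WeierstrassCurve K)
    (vc : VariableChange K) {B2 nu iq iu2 : A} {X0K B2K g2K dK i2 iqK iu2K nuK e t : K}
    (hB2 : φ B2 = B2K) (hnu : φ nu = nuK) (hiqφ : φ iq = iqK) (hiu2φ : φ iu2 = iu2K)
    (h1 : V.a₁ = 1) (h2 : V.a₂ = B2K) (h3 : V.a₃ = 0) (h4 : V.a₄ = 0) (h6 : V.a₆ = g2K * X0K ^ 2)
    (hX0 : X0K = -1 - 4 * B2K - 64 * g2K) (hi2 : (2 : K) * i2 = 1)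
    (hiq : 3 * ((1 + 4 * nuK) ^ 2 - 4 * (1 + 4 * nuK) - 16) * iqK = 1) (hiu2 : (1 + 2 * B2K) * iu2K = 1)
    (hg2 : g2K = (1 + 4 * B2K) * (1 + nuK) * iqK) (hd : dK = -(1 + 4 * nuK) * g2K)
    (he : e = X0K * i2 ^ 2) (ht : t = (3 * X0K ^ 2 + 8 * B2K * X0K + 2 * X0K) * i2 ^ 4)
    (h1' : V'.a₁ = V.a₁) (h2' : V'.a₂ = V.a₂) (h3' : V'.a₃ = V.a₃) (h4' : V'.a₄ = V.a₄ - 5 * t)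
    (h6' : V'.a₆ = V.a₆ - V.b₂ * t - 7 * e * t)
    (hvu : (vc.u : K) = 2 * (1 + 2 * B2K)) (hvr : vc.r = (-X0K + 32 * dK) * i2 ^ 2) (hvs : vc.s = (1 + 2 * B2K) - i2)
    (hvt : vc.t = -((-X0K + 32 * dK) * i2 ^ 2) * i2) :
    vc • V' = (⟨1, (-48 * B2 ^ 2 * nu ^ 2 - 96 * B2 * nu ^ 2 + 24 * B2 ^ 2 * nu - 24 * nu ^ 2 - 72 * B2 * nu + 57 * B2 ^ 2 - 18 * nu +
      24 * B2 + 6) * iq * iu2 ^ 2, 0, 0,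
      (16384 * B2 ^ 3 * nu ^ 6 + 12288 * B2 ^ 2 * nu ^ 6 + 98304 * B2 ^ 3 * nu ^ 5 + 3072 * B2 * nu ^ 6 +
        73728 * B2 ^ 2 * nu ^ 5 + 227328 * B2 ^ 3 * nu ^ 4 + 256 * nu ^ 6 + 18432 * B2 * nu ^ 5 + 170496 * B2 ^ 2 * nu ^ 4 +
        262144 * B2 ^ 3 * nu ^ 3 + 1536 * nu ^ 5 + 42624 * B2 * nu ^ 4 + 196608 * B2 ^ 2 * nu ^ 3 + 158784 * B2 ^ 3 * nu ^ 2 +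
        3552 * nu ^ 4 + 49152 * B2 * nu ^ 3 + 119088 * B2 ^ 2 * nu ^ 2 + 47232 * B2 ^ 3 * nu + 4096 * nu ^ 3 + 29772 * B2 * nu ^ 2 +
        35424 * B2 ^ 2 * nu + 5184 * B2 ^ 3 + 2481 * nu ^ 2 + 8856 * B2 * nu + 3888 * B2 ^ 2 + 738 * nu + 972 * B2 + 81) *
        iq ^ 3 * iu2 ^ 6⟩ : WeierstrassCurve A).map φ := by
  rw [frobModel_curve V V' vc h1 h2 h3 h4 h6 hX0 hi2 hiq hiu2 hg2 hd he ht h1' h2' h3' h4' h6' hvu hvr hvs hvt]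
  ext
  · rw [map_a₁, map_one]
  · rw [map_a₂, ← hB2, ← hnu, ← hiqφ, ← hiu2φ]
    simp only [map_mul, map_add, map_sub, map_neg, map_pow, map_ofNat]
    ring
  · rw [map_a₃, map_zero]
  · rw [map_a₄, map_zero]
  · rw [map_a₆, ← hB2, ← hnu, ← hiqφ, ← hiu2φ]
    simp only [map_mul, map_add, map_pow, map_ofNat]


section Glue

variable {A B : Type*} [CommRing A] [CommRing B] (φ : A →+* B)

/-- `A = Xs − e·z²` with `e = X₀·i₂²`, `C` distributed. [folklore] -/
theorem frob_A_normalForm {Xs A' : B⟦X⟧} {e X0 i2 : B} (hA : A' = Xs - C e * X ^ 2) (he : e = X0 * i2 ^ 2) :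
    A' = Xs - C X0 * C i2 ^ 2 * X ^ 2 := by rw [hA, he, map_mul, map_pow]

/-- `Dn(0) = 1` for Vélu's denominator. [cite: BlakestadGrant2023, Lemma 12] -/
theorem frob_constantCoeff_Dn (V : WeierstrassCurve B) {e f t : B} {A' Dn : B⟦X⟧} (hA : A' = V.formalXMulSq - C e * X ^ 2)
    (hDn : Dn = V.formalXMulSq * A' ^ 2 + C t * X ^ 4 * (C V.a₁ * X * A' - V.formalXMulSq - C f * X ^ 3)) :
    constantCoeff Dn = 1 := by
  have hA0 : constantCoeff A' = 1 := by
    rw [hA, map_sub, map_mul, map_pow, constantCoeff_X, constantCoeff_formalXMulSq]; ring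
  rw [hDn, map_add, map_mul, map_mul, map_mul, map_pow, map_pow, constantCoeff_X, constantCoeff_formalXMulSq, hA0]; ring

/-- Base change of a normalised series: `σ^φ(0) = 0`, `[z¹]σ^φ = 1`. [folklore] -/
theorem frob_map_normalised (α : B →+* B) {σ σ'' : B⟦X⟧} (hσ'' : σ'' = PowerSeries.map α σ) (h0 : constantCoeff σ = 0)
    (h1 : coeff 1 σ = 1) : constantCoeff σ'' = 0 ∧ coeff 1 σ'' = 1 := by
  subst hσ''
  refine ⟨?_, by rw [coeff_map, h1, map_one]⟩
  rw [← coeff_zero_eq_constantCoeff_apply, coeff_map, coeff_zero_eq_constantCoeff_apply, h0, map_zero]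

/-- `T/z = 2·Tₙ` with `Tₙ = i₂·(T/z)`, `Tₙ(0) = u₂` when `[z¹]T = 2u₂`, `2i₂ = 1`. [folklore] -/
theorem frob_sigmaShift_two {i2 u2 : B} (hi2 : (2 : B) * i2 = 1) {T Tn : B⟦X⟧} (hTn : Tn = C i2 * sigmaShift T)
    (hT1 : coeff 1 T = 2 * u2) : sigmaShift T = C (2 : B) * Tn ∧ constantCoeff Tn = u2 := by
  subst hTn
  have hC2 : (C (2 : B) : B⟦X⟧) * C i2 = 1 := by rw [← map_mul, hi2, map_one]
  refine ⟨by rw [← mul_assoc, hC2, one_mul], ?_⟩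
  rw [map_mul, constantCoeff_C, constantCoeff_sigmaShift, hT1]
  linear_combination u2 * hi2

/-- `(σ^α/z)² = (H)^α` for `H = (σ/z)²`. [folklore] -/
theorem frob_map_sigmaShift_sq (α : B →+* B) {σ σ'' H : B⟦X⟧} (hσ'' : σ'' = PowerSeries.map α σ) (hH : H = sigmaShift σ ^ 2) :
    PowerSeries.map α H = sigmaShift σ'' ^ 2 := by
  rw [hH, hσ'', map_pow, sigmaShift_map]

/-- `H(0) = 1` and `[z¹]H = a₁ = 1` for `H = (σ/z)²`, `σ` Mazur–Tate odd and normalised on an `a₁ = 1` curve.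
[cite: MazurSteinTate2006, Thm. 1.3] -/
theorem frob_H_coeffs (W : WeierstrassCurve B) (h1 : W.a₁ = 1) {σ H : B⟦X⟧} (hH : H = sigmaShift σ ^ 2) (hσ0 : constantCoeff σ = 0)
    (hσ1 : coeff 1 σ = 1) (hodd : W.IsFormallyOdd σ) : constantCoeff H = 1 ∧ coeff 1 H = 1 := by
  subst hH
  refine ⟨by rw [map_pow, constantCoeff_sigmaShift, hσ1, one_pow], ?_⟩
  rw [coeff_one_sigmaShift_sq hσ1, WeierstrassCurve.two_mul_coeff_two_of_isFormallyOdd W hodd hσ0 hσ1, h1]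

/-- `σ² = z²·H ∈ S⟦z⟧` when `H ∈ S⟦z⟧`. [folklore] -/
theorem frob_coeff_sq_mem (S : Subring B) {σ H : B⟦X⟧} (hH : H = sigmaShift σ ^ 2) (hσ0 : constantCoeff σ = 0)
    (hmem : ∀ n, coeff n H ∈ S) (n : ℕ) : coeff n (σ ^ 2) ∈ S := by
  have hσsq : σ ^ 2 = X ^ 2 * H := by rw [hH, ← mul_pow X (sigmaShift σ) 2, X_mul_sigmaShift hσ0]
  rw [hσsq, coeff_X_pow_mul']
  split_ifs
  · exact hmem _
  · exact zero_mem _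

/-- **`T = φ_*(N₂·𝔇⁻¹)`**: if `T·𝔇^φ = N₂^φ` over `B` and `𝔇·𝔇⁻¹ = 1` over `A`. [cite: BlakestadGrant2023, Lemma 12] -/
theorem frob_T_eq_map {T cDK N2K : B⟦X⟧} {cDR invD N2R TR : A⟦X⟧} (hTD : T * cDK = N2K) (hmapD : PowerSeries.map φ cDR = cDK)
    (hmapN : PowerSeries.map φ N2R = N2K) (hinv : cDR * invD = 1) (hTR : TR = N2R * invD) : T = PowerSeries.map φ TR := by
  have e1 : PowerSeries.map φ cDR * PowerSeries.map φ invD = 1 := by rw [← map_mul, hinv, map_one]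
  calc T = T * (PowerSeries.map φ cDR * PowerSeries.map φ invD) := by rw [e1, mul_one]
    _ = (T * cDK) * PowerSeries.map φ invD := by rw [hmapD]; ring
    _ = PowerSeries.map φ TR := by rw [hTD, ← hmapN, hTR, map_mul]

/-- **`V = φ_*(𝔇²·(𝒬𝒰²)⁻¹)`**. [cite: BlakestadGrant2023, Prop. 13] -/
theorem frob_V_eq_map {VD cDK cQK cUK : B⟦X⟧} {cDR cQR cUR invQ VR : A⟦X⟧} (hVeq : VD = cDK ^ 2 * invOfUnit (cQK * cUK ^ 2) 1)
    (hmapD : PowerSeries.map φ cDR = cDK) (hmapQ : PowerSeries.map φ cQR = cQK) (hmapU : PowerSeries.map φ cUR = cUK)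
    (hQ0 : constantCoeff cQR = 1) (hU0 : constantCoeff cUR = 1) (hinvQ : invQ = invOfUnit (cQR * cUR ^ 2) 1)
    (hVR : VR = cDR ^ 2 * invQ) : VD = PowerSeries.map φ VR := by
  have hQU0 : constantCoeff (cQR * cUR ^ 2) = 1 := by rw [map_mul, map_pow, hQ0, hU0]; ring
  rw [hVeq, hVR, map_mul, map_pow, hmapD, hinvQ, Literature.NumberTheory.EllipticCurves.map_invOfUnit_one φ _ hQU0, map_mul, map_pow,
    hmapQ, hmapU]

/-- **Dwork's `hφ`**: `T = φ_*(N₂𝔇⁻¹)` with `N₂ − z²𝔇 ∈ 2A⟦z⟧` ⟹ `[zⁿ]T = δ_{n,2} + 2a`, `a ∈ φ(A)`. [cite: Koblitz1984, Ch. IV §2 Lemma 3] -/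
theorem frob_dwork_hφ {T : B⟦X⟧} {cDR invD N2R TR : A⟦X⟧} (hinv : cDR * invD = 1) (hTR : TR = N2R * invD)
    (hmem : ∀ n, coeff n (N2R - X ^ 2 * cDR) ∈ Ideal.span {(2 : A)}) (hT : T = PowerSeries.map φ TR) (n : ℕ) :
    ∃ a ∈ φ.range, coeff n T = (if n = 2 then 1 else 0) + ((2 : ℕ) : B) * a := by
  have hdiff : TR - X ^ 2 = (N2R - X ^ 2 * cDR) * invD := by rw [hTR]; linear_combination (X ^ 2) * hinv
  have hm : coeff n (TR - X ^ 2) ∈ Ideal.span {(2 : A)} := by rw [hdiff]; exact coeff_mul_mem_of_coeff_mem _ hmem _ n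
  obtain ⟨a, ha⟩ := Ideal.mem_span_singleton'.mp hm
  refine ⟨φ a, ⟨a, rfl⟩, ?_⟩
  have e : coeff n TR = (if n = 2 then 1 else 0) + a * 2 := by
    rw [map_sub, coeff_X_pow] at ha
    linear_combination -ha
  rw [hT, coeff_map, Nat.cast_ofNat, e, map_add, map_mul, map_ofNat]
  split_ifs <;> simp [mul_comm]

/-- **Dwork's `hu0`, `hu`**: `V = φ_*(𝔇²(𝒬𝒰²)⁻¹)` with `𝔇² − 𝒬𝒰² ∈ 2A⟦z⟧` ⟹ `V(0) = 1`, `[zⁿ⁺¹]V = 2a`, `a ∈ φ(A)`.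
[cite: Koblitz1984, Ch. IV §2 Lemma 3] -/
theorem frob_dwork_hu {VD : B⟦X⟧} {cDR cQR cUR invQ VR : A⟦X⟧} (hQ0 : constantCoeff cQR = 1) (hU0 : constantCoeff cUR = 1)
    (hD0 : constantCoeff cDR = 1) (hinvQ : invQ = invOfUnit (cQR * cUR ^ 2) 1) (hVR : VR = cDR ^ 2 * invQ)
    (hmem : ∀ n, coeff n (cDR ^ 2 - cQR * cUR ^ 2) ∈ Ideal.span {(2 : A)}) (hV : VD = PowerSeries.map φ VR) :
    constantCoeff VD = 1 ∧ ∀ n, ∃ a ∈ φ.range, coeff (n + 1) VD = ((2 : ℕ) : B) * a := by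
  have hQU0 : constantCoeff (cQR * cUR ^ 2) = 1 := by rw [map_mul, map_pow, hQ0, hU0]; ring
  have hinvQ1 : (cQR * cUR ^ 2) * invQ = 1 := by rw [hinvQ]; exact mul_invOfUnit _ 1 (by rw [hQU0, Units.val_one])
  have hVR0 : constantCoeff VR = 1 := by
    rw [hVR, map_mul, map_pow, hD0, hinvQ, constantCoeff_invOfUnit, inv_one, Units.val_one]; ring
  refine ⟨by rw [hV, ← coeff_zero_eq_constantCoeff_apply, coeff_map, coeff_zero_eq_constantCoeff_apply, hVR0, map_one], fun n => ?_⟩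
  have hdiff : VR - 1 = (cDR ^ 2 - cQR * cUR ^ 2) * invQ := by rw [hVR]; linear_combination hinvQ1
  have hm : coeff (n + 1) (VR - 1) ∈ Ideal.span {(2 : A)} := by rw [hdiff]; exact coeff_mul_mem_of_coeff_mem _ hmem _ (n + 1)
  obtain ⟨a, ha⟩ := Ideal.mem_span_singleton'.mp hm
  refine ⟨φ a, ⟨a, rfl⟩, ?_⟩
  have e : coeff (n + 1) VR = a * 2 := by
    rw [map_sub, coeff_one, if_neg (Nat.succ_ne_zero n), sub_zero] at ha
    exact ha.symm
  rw [hV, coeff_map, e, map_mul, map_ofNat, Nat.cast_ofNat, mul_comm]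

end Glue

end Summit.BirchSwinnertonDyer.BirchSwinnertonDyer.Theorems.AlignedTransportAtTwoSigmaSqTwo
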